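import Summits.RiemannHypothesis.RiemannHypothesis.Theorems.SuzukiHSWindow
import Summits.RiemannHypothesis.RiemannHypothesis.Theorems.SuzukiWindowsDoorExplicitSymbol

/-!
# SuzukiWindowsDoorExplicitWindow — explicit unit-eigenvalue-free windows for Suzuki's single operator `𝖪_θ[t]`, IN THE KERNEL (column DBR; RH-FREE)

RH-FREE throughout; nothing here bears on the truth of RH (a clean window certifies nothing about RH; every
window below is a finite instance of the `∀ t`-clause of the RH-EQUIVALENT residual `AllWindowsWitness`, never
evidence for it).  [Su20] = M. Suzuki, ASPM 84 (2020) 399–411 = arXiv:1907.07302, Thm 1.2 (K-v): for `θ > 1`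
there is an INEXPLICIT `τ > 0` with `±1 ∉ σ_p(𝖪_θ[t])` for `0 ≤ t < τ` (tree: `Suzuki2020_thm12_Kv`).  Here `τ`
is made EXPLICIT from the spectral side only (no zeros of `ζ`), continuing `SuzukiWindowsDoorExplicitSymbol`
(line bound `|K_θ(x)| ≤ (2π)^{θ−1} π√(2/θ) e^{2θε(σ)} σ^{1−θ} e^{(σ−½)x}`, `ε(σ) = 1/(6σ²)+1/(πσ³)+(π²/6)2^{3−σ}`):
* §5 the ONSET ENVELOPE `|K_θ(x)| ≤ A_θ(σ₀) x^{θ−1}` for `0 < x ≤ (θ−1)/σ₀` (line `Re s = (θ−1)/x`),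
  `A_θ(σ₀) = (2π)^{θ−1} π √(2/θ) (e/(θ−1))^{θ−1} e^{2θ ε(σ₀)}` — same order as the true onset `(2π)^θ x^{θ−1}/Γ(θ)`;
* §6 `h(t) = ∫₀^{2t} (2t−u) K_θ(u)² du ≤ A_θ(σ₀)² (2t)^{2θ}/((2θ−1)2θ)` and `NoUnitEigenvalue (limKernel θ) t`
  whenever `2tσ₀ ≤ θ−1` and `A_θ(σ₀)²(2t)^{2θ} < (2θ−1)2θ` (weighted Hilbert–Schmidt test of `SuzukiHSWindow`);
* §7 the window `t ≤ (θ−1)/36` for EVERY `θ ≥ 2`, a rational evaluation form, and the instances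
  `θ = 12, 20, 24, 40`: `t ≤ 0.42, 0.66, 0.78, 1.25`.
-/

noncomputable section

-- D-0017: `Summit.<S>.<S>.…` is the designed namespace of a single-problem summit.
set_option linter.dupNamespace false

open MeasureTheory Set Filter Topology Complex

namespace Summit.RiemannHypothesis.RiemannHypothesis.Theorems.SuzukiWindowsDoorExplicitWindow

open Literature.NumberTheory.LFunctions
open Summit.RiemannHypothesis.RiemannHypothesis.Theorems.SuzukiWindowsDoorExplicitSymbol

/-! ## §5 The onset envelope `|K_θ(x)| ≤ A_θ(σ₀) x^{θ−1}` (line `σ = (θ−1)/x`) -/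

/-- `ε(σ) ≤ ε(σ₀)` for `σ ≥ σ₀ > 0` (each of the three terms is antitone). -/
theorem eps_antitone {σ₀ σ : ℝ} (hσ₀ : 0 < σ₀) (h : σ₀ ≤ σ) :
    1 / (6 * σ ^ 2) + 1 / (Real.pi * σ ^ 3) + Real.pi ^ 2 / 6 * (2 : ℝ) ^ (3 - σ) ≤
      1 / (6 * σ₀ ^ 2) + 1 / (Real.pi * σ₀ ^ 3) + Real.pi ^ 2 / 6 * (2 : ℝ) ^ (3 - σ₀) := by
  have hσ : 0 < σ := lt_of_lt_of_le hσ₀ h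
  have h1 : 1 / (6 * σ ^ 2) ≤ 1 / (6 * σ₀ ^ 2) := by gcongr
  have h2 : 1 / (Real.pi * σ ^ 3) ≤ 1 / (Real.pi * σ₀ ^ 3) := by gcongr
  have h3 : (2 : ℝ) ^ (3 - σ) ≤ (2 : ℝ) ^ (3 - σ₀) :=
    Real.rpow_le_rpow_of_exponent_le (by norm_num) (by linarith)
  have h4 : Real.pi ^ 2 / 6 * (2 : ℝ) ^ (3 - σ) ≤ Real.pi ^ 2 / 6 * (2 : ℝ) ^ (3 - σ₀) :=
    mul_le_mul_of_nonneg_left h3 (by positivity)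
  linarith

/-- **ONSET ENVELOPE** (RH-free): for `θ ≥ 2`, `σ₀ ≥ 3` and `0 < x` with `x σ₀ ≤ θ − 1`,
`|K_θ(x)| ≤ A_θ(σ₀) · x^{θ−1}`, `A_θ(σ₀) = (2π)^{θ−1} · π√(2/θ) · (e/(θ−1))^{θ−1} · e^{2θ ε(σ₀)}` —
§4 on the line `σ = (θ−1)/x` (the saddle of `σ^{1−θ} e^{σx}`), where `σ^{1−θ} e^{(σ−½)x} = (e x/(θ−1))^{θ−1} e^{−x/2}`.
Same order `x^{θ−1}` as the true onset `c_θ x^{θ−1}`, `c_θ = (2π)^θ/Γ(θ)`; `A_θ/c_θ = Γ(θ)(e/(θ−1))^{θ−1}√(θ/2)·e^{2θε}/2 ≈ 1.7`. -/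
theorem abs_limKernel_le_onset {θ σ₀ x : ℝ} (hθ : 2 ≤ θ) (hσ₀ : 3 ≤ σ₀) (hx : 0 < x) (hxσ : x * σ₀ ≤ θ - 1) :
    |limKernel θ x| ≤
      (2 * Real.pi) ^ (θ - 1) * (Real.pi * Real.sqrt (2 / θ)) * (Real.exp 1 / (θ - 1)) ^ (θ - 1)
        * Real.exp (2 * θ * (1 / (6 * σ₀ ^ 2) + 1 / (Real.pi * σ₀ ^ 3) + Real.pi ^ 2 / 6 * (2 : ℝ) ^ (3 - σ₀)))
        * x ^ (θ - 1) := by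
  set σ : ℝ := (θ - 1) / x with hσdef
  set b : ℝ := σ - 1 / 2 with hbdef
  have hθ1 : 0 < θ - 1 := by linarith
  have hσ₀0 : 0 < σ₀ := by linarith
  have hσσ₀ : σ₀ ≤ σ := by rw [hσdef, le_div_iff₀ hx]; linarith
  have hσ0 : 0 < σ := lt_of_lt_of_le hσ₀0 hσσ₀
  have hb : 5 / 2 ≤ b := by rw [hbdef]; linarith
  have hline := abs_limKernel_le_line hθ hb x
  have hσb : 1 / 2 + b = σ := by rw [hbdef]; ring
  rw [hσb] at hline
  -- the exponential factor on the line `σ = (θ−1)/x`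
  have hσx : σ * x = θ - 1 := by rw [hσdef]; field_simp
  have hexp : Real.exp (b * x) ≤ Real.exp 1 ^ (θ - 1) := by
    rw [Real.exp_one_rpow, Real.exp_le_exp, hbdef]
    nlinarith
  have hpow : σ ^ (1 - θ) = (1 / (θ - 1)) ^ (θ - 1) * x ^ (θ - 1) := by
    have : σ = (θ - 1) * x⁻¹ := by rw [hσdef, div_eq_mul_inv]
    rw [this, show (1 : ℝ) - θ = -(θ - 1) by ring, Real.rpow_neg (by positivity),
      Real.mul_rpow hθ1.le (by positivity), Real.inv_rpow hx.le, one_div, Real.inv_rpow hθ1.le]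
    field_simp
  have heps := eps_antitone hσ₀0 hσσ₀
  set E₀ := Real.exp (2 * θ * (1 / (6 * σ₀ ^ 2) + 1 / (Real.pi * σ₀ ^ 3) + Real.pi ^ 2 / 6 * (2 : ℝ) ^ (3 - σ₀)))
    with hE₀
  have hE : Real.exp (2 * θ * (1 / (6 * σ ^ 2) + 1 / (Real.pi * σ ^ 3) + Real.pi ^ 2 / 6 * (2 : ℝ) ^ (3 - σ)))
      ≤ E₀ := by
    rw [hE₀, Real.exp_le_exp]
    exact mul_le_mul_of_nonneg_left heps (by linarith)
  set P : ℝ := (2 * Real.pi) ^ (θ - 1) * (Real.pi * Real.sqrt (2 / θ)) with hP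
  have hP0 : 0 ≤ P := by positivity
  calc |limKernel θ x|
      ≤ P * Real.exp (2 * θ * (1 / (6 * σ ^ 2) + 1 / (Real.pi * σ ^ 3) + Real.pi ^ 2 / 6 * (2 : ℝ) ^ (3 - σ)))
          * σ ^ (1 - θ) * Real.exp (b * x) := hline
    _ ≤ P * E₀ * σ ^ (1 - θ) * Real.exp 1 ^ (θ - 1) := by gcongr
    _ = P * (Real.exp 1 / (θ - 1)) ^ (θ - 1) * E₀ * x ^ (θ - 1) := by
        rw [hpow, div_eq_mul_one_div (Real.exp 1) (θ - 1), Real.mul_rpow (Real.exp_pos 1).le (by positivity)]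
        ring

/-! ## §6 The weighted Hilbert–Schmidt sum `h(t) = ∫₀^{2t}(2t−u)K_θ(u)² du ≤ A² (2t)^{2θ}/((2θ−1)2θ)` and the windows -/

/-- `∫₀^T (T − u) · C u^m du = C T^{m+2}/((m+1)(m+2))` for `T ≥ 0`, `m ≥ 1` (fundamental theorem of calculus). -/
theorem integral_weight_mul_rpow {T m C : ℝ} (hT : 0 ≤ T) (hm : 1 ≤ m) :
    ∫ u in (0 : ℝ)..T, (T - u) * (C * u ^ m) = C * T ^ (m + 2) / ((m + 1) * (m + 2)) := by
  have hm1 : m + 1 ≠ 0 := by linarith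
  have hm2 : m + 2 ≠ 0 := by linarith
  set F : ℝ → ℝ := fun u => C * (T * u ^ (m + 1) / (m + 1) - u ^ (m + 2) / (m + 2)) with hF
  have hderiv : ∀ u ∈ uIcc (0 : ℝ) T, HasDerivAt F ((T - u) * (C * u ^ m)) u := by
    intro u hu
    have hu0 : 0 ≤ u := by rw [uIcc_of_le hT] at hu; exact hu.1
    have h1 : HasDerivAt (fun v : ℝ => v ^ (m + 1)) ((m + 1) * u ^ (m + 1 - 1)) u :=
      Real.hasDerivAt_rpow_const (Or.inr (by linarith))
    have h2 : HasDerivAt (fun v : ℝ => v ^ (m + 2)) ((m + 2) * u ^ (m + 2 - 1)) u :=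
      Real.hasDerivAt_rpow_const (Or.inr (by linarith))
    refine ((((h1.const_mul T).div_const (m + 1)).sub (h2.div_const (m + 2))).const_mul C).congr_deriv ?_
    rw [show m + 1 - 1 = m by ring, show m + 2 - 1 = m + 1 by ring, Real.rpow_add' hu0 hm1, Real.rpow_one]
    field_simp
  have hcont : Continuous fun u : ℝ => (T - u) * (C * u ^ m) :=
    (continuous_const.sub continuous_id).mul
      (continuous_const.mul (continuous_id.rpow_const fun _ => Or.inr (by linarith)))
  rw [intervalIntegral.integral_eq_sub_of_hasDerivAt hderiv (hcont.intervalIntegrable _ _)]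
  simp only [hF]
  have hP : T ^ (m + 2) = T ^ (m + 1) * T := by
    rw [show m + 2 = (m + 1) + 1 by ring, Real.rpow_add' hT (by linarith), Real.rpow_one]
  rw [Real.zero_rpow hm1, Real.zero_rpow hm2, hP]
  field_simp
  ring

/-- **`h(t)` under the onset envelope** (RH-free): for `θ ≥ 2`, `σ₀ ≥ 3`, `t > 0` with `2t σ₀ ≤ θ − 1`,
`∫₀^{2t} (2t − u) K_θ(u)² du ≤ A_θ(σ₀)² (2t)^{2θ} / ((2θ−1)·2θ)`. -/
theorem weightedSq_limKernel_le {θ σ₀ t : ℝ} (hθ : 2 ≤ θ) (hσ₀ : 3 ≤ σ₀) (ht : 0 < t)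
    (htσ : 2 * t * σ₀ ≤ θ - 1) :
    ∫ u in (0 : ℝ)..(2 * t), (2 * t - u) * limKernel θ u ^ 2 ≤
      ((2 * Real.pi) ^ (θ - 1) * (Real.pi * Real.sqrt (2 / θ)) * (Real.exp 1 / (θ - 1)) ^ (θ - 1)
        * Real.exp (2 * θ * (1 / (6 * σ₀ ^ 2) + 1 / (Real.pi * σ₀ ^ 3) + Real.pi ^ 2 / 6 * (2 : ℝ) ^ (3 - σ₀)))) ^ 2
        * (2 * t) ^ (2 * θ) / ((2 * θ - 1) * (2 * θ)) := by
  set A : ℝ := (2 * Real.pi) ^ (θ - 1) * (Real.pi * Real.sqrt (2 / θ)) * (Real.exp 1 / (θ - 1)) ^ (θ - 1)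
        * Real.exp (2 * θ * (1 / (6 * σ₀ ^ 2) + 1 / (Real.pi * σ₀ ^ 3) + Real.pi ^ 2 / 6 * (2 : ℝ) ^ (3 - σ₀)))
    with hA
  set T : ℝ := 2 * t with hT
  have hT0 : 0 ≤ T := by rw [hT]; linarith
  have hθ1 : 1 < θ := by linarith
  have hm : (1 : ℝ) ≤ 2 * θ - 2 := by linarith
  have hK : Continuous (limKernel θ) := Suzuki2020_thm12_continuous hθ1
  have hθpos : 0 < θ - 1 := by linarith
  have hA0 : 0 ≤ A := by rw [hA]; positivity
  -- pointwise comparison on `[0, T]`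
  have hpt : ∀ u ∈ Icc (0 : ℝ) T, (T - u) * limKernel θ u ^ 2 ≤ (T - u) * (A ^ 2 * u ^ (2 * θ - 2)) := by
    intro u hu
    refine mul_le_mul_of_nonneg_left ?_ (by linarith [hu.2])
    rcases eq_or_lt_of_le hu.1 with h0 | hu0
    · -- `u = 0`: `K_θ(0) = 0`
      rw [← h0, SuzukiHSWindow.apply_zero_eq_zero_of_vanishing hK (fun v hv => Suzuki2020_thm12_Kiii hθ1 hv)]
      have : (0 : ℝ) ^ (2 * θ - 2) = 0 := Real.zero_rpow (by linarith)
      rw [this]; simp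
    · have henv := abs_limKernel_le_onset hθ hσ₀ hu0 (by nlinarith [hu.2])
      have hsq : limKernel θ u ^ 2 = |limKernel θ u| ^ 2 := (sq_abs _).symm
      rw [hsq]
      calc |limKernel θ u| ^ 2 ≤ (A * u ^ (θ - 1)) ^ 2 :=
            pow_le_pow_left₀ (abs_nonneg _) henv 2
        _ = A ^ 2 * u ^ (2 * θ - 2) := by
            rw [mul_pow, show (2 : ℝ) * θ - 2 = (θ - 1) * 2 by ring, Real.rpow_mul hu0.le]
            norm_cast
  have hf : IntervalIntegrable (fun u => (T - u) * limKernel θ u ^ 2) volume 0 T :=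
    ((continuous_const.sub continuous_id).mul (hK.pow 2)).intervalIntegrable _ _
  have hg : IntervalIntegrable (fun u : ℝ => (T - u) * (A ^ 2 * u ^ (2 * θ - 2))) volume 0 T :=
    ((continuous_const.sub continuous_id).mul
      (continuous_const.mul (continuous_id.rpow_const fun _ => Or.inr (by linarith)))).intervalIntegrable _ _
  calc ∫ u in (0 : ℝ)..T, (T - u) * limKernel θ u ^ 2
      ≤ ∫ u in (0 : ℝ)..T, (T - u) * (A ^ 2 * u ^ (2 * θ - 2)) :=
        intervalIntegral.integral_mono_on hT0 hf hg hpt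
    _ = A ^ 2 * T ^ (2 * θ - 2 + 2) / ((2 * θ - 2 + 1) * (2 * θ - 2 + 2)) := integral_weight_mul_rpow hT0 hm
    _ = A ^ 2 * T ^ (2 * θ) / ((2 * θ - 1) * (2 * θ)) := by
        rw [show (2 : ℝ) * θ - 2 + 2 = 2 * θ by ring, show (2 : ℝ) * θ - 2 + 1 = 2 * θ - 1 by ring]

/-- **EXPLICIT CLEAN WINDOWS for Suzuki's single operator** (RH-free; [Su20] Thm 1.2 (K-v) with an explicit `τ`):
for `θ ≥ 2`, `σ₀ ≥ 3`, `2tσ₀ ≤ θ − 1` and `A_θ(σ₀)² (2t)^{2θ} < (2θ−1)·2θ`, `±1` is not an eigenvalue of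
`𝖪_θ[t]` on `L²(−t,t)` (`NoUnitEigenvalue (limKernel θ) t`), by the weighted Hilbert–Schmidt test
`SuzukiHSWindow.limKernel_noUnitEigenvalue_of_weightedSq_lt_one` (`h(t) < 1`).  A clean window certifies nothing about RH. -/
theorem noUnitEigenvalue_limKernel_explicit {θ σ₀ t : ℝ} (hθ : 2 ≤ θ) (hσ₀ : 3 ≤ σ₀)
    (htσ : 2 * t * σ₀ ≤ θ - 1)
    (hcond : ((2 * Real.pi) ^ (θ - 1) * (Real.pi * Real.sqrt (2 / θ)) * (Real.exp 1 / (θ - 1)) ^ (θ - 1)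
        * Real.exp (2 * θ * (1 / (6 * σ₀ ^ 2) + 1 / (Real.pi * σ₀ ^ 3) + Real.pi ^ 2 / 6 * (2 : ℝ) ^ (3 - σ₀)))) ^ 2
        * (2 * t) ^ (2 * θ) < (2 * θ - 1) * (2 * θ)) :
    NoUnitEigenvalue (limKernel θ) t := by
  have hθ1 : 1 < θ := by linarith
  rcases le_or_gt t 0 with ht | ht
  · -- empty window
    exact noUnitEigenvalue_of_small_window (M := 0) (fun u hu => by
      have := abs_nonneg u; linarith) (by simp)
  · refine SuzukiHSWindow.limKernel_noUnitEigenvalue_of_weightedSq_lt_one hθ1 ?_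
    have hpos : 0 < (2 * θ - 1) * (2 * θ) := by nlinarith
    calc ∫ u in (0 : ℝ)..(2 * t), (2 * t - u) * limKernel θ u ^ 2
        ≤ _ := weightedSq_limKernel_le hθ hσ₀ ht htσ
      _ < 1 := by rwa [div_lt_one hpos]

/-! ## §7 A window for EVERY `θ ≥ 2`: `t ≤ (θ−1)/36`; numeric evaluation form and sharper instances -/

/-- `ε(18) ≤ 1/1600` (`π > 3`, `π < 3.1416`, `2^{3−18} = 2^{−15}`). -/
theorem eps_eighteen_le :
    1 / (6 * (18 : ℝ) ^ 2) + 1 / (Real.pi * (18 : ℝ) ^ 3) + Real.pi ^ 2 / 6 * (2 : ℝ) ^ ((3 : ℝ) - 18)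
      ≤ 1 / 1600 := by
  have hπ3 := Real.pi_gt_three
  have hπ := Real.pi_lt_d4
  have h1 : 1 / (Real.pi * (18 : ℝ) ^ 3) ≤ 1 / (3 * (18 : ℝ) ^ 3) := by
    gcongr
  have h2 : (2 : ℝ) ^ ((3 : ℝ) - 18) = 1 / 2 ^ 15 := by
    rw [show (3 : ℝ) - 18 = -((15 : ℕ) : ℝ) by norm_num, Real.rpow_neg (by norm_num), Real.rpow_natCast,
      one_div]
  have h3 : Real.pi ^ 2 ≤ (3.1416 : ℝ) ^ 2 := by
    gcongr
  have h4 : Real.pi ^ 2 / 6 * (2 : ℝ) ^ ((3 : ℝ) - 18) ≤ (3.1416 : ℝ) ^ 2 / 6 * (1 / 2 ^ 15) := by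
    rw [h2]; gcongr
  have h5 : 1 / (3 * (18 : ℝ) ^ 3) + (3.1416 : ℝ) ^ 2 / 6 * (1 / 2 ^ 15) + 1 / (6 * (18 : ℝ) ^ 2)
      ≤ 1 / 1600 := by norm_num
  linarith

/-- **A UNIT-EIGENVALUE-FREE WINDOW FOR EVERY `θ ≥ 2`** (RH-free; [Su20] Thm 1.2 (K-v) with the explicit
`τ(θ) = (θ−1)/36`): for `θ ≥ 2` and `t ≤ (θ − 1)/36`, `±1` is not an eigenvalue of `𝖪_θ[t]` on `L²(−t,t)`.
(§6 with `σ₀ = 18`: the test quantity is at most `(π e^{2ε(18)} (θ−1)/18)² (2πe·e^{2ε(18)}/18)^{2(θ−1)}` and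
`2πe·e^{2ε(18)}/18 < 0.952`.)  The window grows linearly in `θ`, the rate `1/36` being within `4 %` of the
method's asymptotic rate `1/(4πe)`.  A clean window certifies nothing about RH. -/
theorem noUnitEigenvalue_limKernel_of_le {θ t : ℝ} (hθ : 2 ≤ θ) (ht : t ≤ (θ - 1) / 36) :
    NoUnitEigenvalue (limKernel θ) t := by
  have hθ0 : 0 < θ := by linarith
  have hθ1 : 0 < θ - 1 := by linarith
  have hθne : θ - 1 ≠ 0 := ne_of_gt hθ1
  rcases le_or_gt t 0 with ht0 | ht0
  · exact noUnitEigenvalue_of_small_window (M := 0) (fun u hu => by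
      have := abs_nonneg u; linarith) (by simp)
  refine noUnitEigenvalue_limKernel_explicit hθ (σ₀ := 18) (by norm_num) (by linarith) ?_
  set ε : ℝ := 1 / (6 * (18 : ℝ) ^ 2) + 1 / (Real.pi * (18 : ℝ) ^ 3)
    + Real.pi ^ 2 / 6 * (2 : ℝ) ^ ((3 : ℝ) - 18) with hε
  have hε0 : 0 ≤ ε := by positivity
  have hε1 : ε ≤ 1 / 1600 := eps_eighteen_le
  -- `exp(2ε) ≤ 1 + 1/400`
  have hexp : Real.exp (2 * ε) ≤ 1 + 1 / 400 := by
    have h := (abs_le.mp (Real.abs_exp_sub_one_sub_id_le (x := 2 * ε)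
      (by rw [abs_of_nonneg (by positivity)]; linarith))).2
    nlinarith
  have hp := Real.pi_lt_d4.le
  have he := Real.exp_one_lt_d9.le
  -- the geometric ratio `q = 2πe·e^{2ε}/18 ≤ 1`
  have hq1 : 2 * Real.pi * Real.exp 1 / 18 * Real.exp (2 * ε) ≤ 1 := by
    have h1 : 2 * Real.pi * Real.exp 1 / 18 ≤ 2 * 3.1416 * 2.7182818286 / 18 := by gcongr
    calc 2 * Real.pi * Real.exp 1 / 18 * Real.exp (2 * ε)
        ≤ 2 * 3.1416 * 2.7182818286 / 18 * (1 + 1 / 400) := by gcongr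
      _ ≤ 1 := by norm_num
  -- abbreviations
  set a : ℝ := (θ - 1) / 18 with ha
  have ha0 : 0 < a := by rw [ha]; positivity
  have hs0 : 0 ≤ 2 * t := by linarith
  have hs1 : 2 * t ≤ a := by rw [ha]; linarith
  have hsa : (2 * t) ^ θ ≤ a ^ θ := Real.rpow_le_rpow hs0 hs1 hθ0.le
  have haθ : a ^ θ = a ^ (θ - 1) * a := by
    have h := Real.rpow_add ha0 (θ - 1) 1
    rwa [sub_add_cancel, Real.rpow_one] at h
  have hprod : (2 * Real.pi) ^ (θ - 1) * (Real.exp 1 / (θ - 1)) ^ (θ - 1) * a ^ (θ - 1)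
      = (2 * Real.pi * Real.exp 1 / 18) ^ (θ - 1) := by
    have h2π : (0 : ℝ) ≤ 2 * Real.pi := by positivity
    have hQ : (0 : ℝ) ≤ Real.exp 1 / (θ - 1) := by positivity
    calc (2 * Real.pi) ^ (θ - 1) * (Real.exp 1 / (θ - 1)) ^ (θ - 1) * a ^ (θ - 1)
        = (2 * Real.pi * (Real.exp 1 / (θ - 1))) ^ (θ - 1) * a ^ (θ - 1) := by
          rw [Real.mul_rpow h2π hQ]
      _ = (2 * Real.pi * (Real.exp 1 / (θ - 1)) * a) ^ (θ - 1) := by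
          rw [Real.mul_rpow (mul_nonneg h2π hQ) ha0.le]
      _ = (2 * Real.pi * Real.exp 1 / 18) ^ (θ - 1) := by
          congr 1; rw [ha]; field_simp
  have hE : Real.exp (2 * θ * ε) = Real.exp (2 * ε) ^ (θ - 1) * Real.exp (2 * ε) := by
    rw [← Real.exp_mul, ← Real.exp_add]; congr 1; ring
  have hq : (2 * Real.pi * Real.exp 1 / 18) ^ (θ - 1) * Real.exp (2 * ε) ^ (θ - 1) ≤ 1 := by
    rw [← Real.mul_rpow (by positivity) (by positivity)]
    exact Real.rpow_le_one (by positivity) hq1 hθ1.le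
  have hsqrt : Real.sqrt (2 / θ) ≤ 1 := Real.sqrt_le_one.mpr (by rw [div_le_one hθ0]; linarith)
  -- the main product
  have hmain : (2 * Real.pi) ^ (θ - 1) * (Real.pi * Real.sqrt (2 / θ)) * (Real.exp 1 / (θ - 1)) ^ (θ - 1)
      * Real.exp (2 * θ * ε) * (2 * t) ^ θ ≤ Real.pi * a * Real.exp (2 * ε) := by
    calc (2 * Real.pi) ^ (θ - 1) * (Real.pi * Real.sqrt (2 / θ)) * (Real.exp 1 / (θ - 1)) ^ (θ - 1)
          * Real.exp (2 * θ * ε) * (2 * t) ^ θ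
        ≤ (2 * Real.pi) ^ (θ - 1) * (Real.pi * 1) * (Real.exp 1 / (θ - 1)) ^ (θ - 1)
          * Real.exp (2 * θ * ε) * a ^ θ := by gcongr
      _ = Real.pi * a * Real.exp (2 * ε) *
          ((2 * Real.pi * Real.exp 1 / 18) ^ (θ - 1) * Real.exp (2 * ε) ^ (θ - 1)) := by
          rw [haθ, hE, ← hprod]; ring
      _ ≤ Real.pi * a * Real.exp (2 * ε) * 1 := by gcongr
      _ = Real.pi * a * Real.exp (2 * ε) := mul_one _
  have hR : Real.pi * a * Real.exp (2 * ε) ≤ 3.1416 * a * (1 + 1 / 400) := by gcongr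
  have hY := hmain.trans hR
  have hY0 : 0 ≤ (2 * Real.pi) ^ (θ - 1) * (Real.pi * Real.sqrt (2 / θ)) * (Real.exp 1 / (θ - 1)) ^ (θ - 1)
      * Real.exp (2 * θ * ε) * (2 * t) ^ θ := by positivity
  have hY2 := mul_le_mul hY hY hY0 (by positivity)
  have hpow2 : (2 * t) ^ (2 * θ) = ((2 * t) ^ θ) ^ 2 := by
    rw [mul_comm (2 : ℝ) θ, Real.rpow_mul hs0, Real.rpow_two]
  rw [hpow2]
  rw [ha] at hY2
  nlinarith [hY2, hθ]

/-- **Numeric evaluation form** (RH-free): for natural `θ = n ≥ 2` and `σ₀ = m ≥ 3`, rational upper bounds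
`π ≤ p`, `e ≤ q`, `√(2/n) ≤ r`, `2n ε⁺ ≤ a ≤ 1` with `ε⁺ = 1/(6m²) + 1/(3m³) + (p²/6)·8/2^m ≥ ε(m)`, a window bound
`t ≤ T` with `2Tm ≤ n − 1`, and the RATIONAL test `((2p)^{n−1}·p r·(q/(n−1))^{n−1}·(1 + a + a²))²(2T)^{2n} < (2n−1)2n`
give `NoUnitEigenvalue (limKernel n) t` (§6 with every transcendental replaced by its bound; `e^a ≤ 1 + a + a²`,
Mathlib's `Real.abs_exp_sub_one_sub_id_le`). -/
theorem noUnitEigenvalue_limKernel_of_rat_bounds {n m : ℕ} (hn : 2 ≤ n) (hm : 3 ≤ m) {t T p q r a : ℝ}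
    (hp : Real.pi ≤ p) (hq : Real.exp 1 ≤ q) (hr : Real.sqrt (2 / n) ≤ r)
    (ha : 2 * n * (1 / (6 * (m : ℝ) ^ 2) + 1 / (3 * (m : ℝ) ^ 3) + p ^ 2 / 6 * (8 / 2 ^ m)) ≤ a) (ha1 : a ≤ 1)
    (htT : t ≤ T) (hTm : 2 * T * m ≤ n - 1)
    (hcond : ((2 * p) ^ (n - 1) * (p * r) * (q / (n - 1)) ^ (n - 1) * (1 + a + a ^ 2)) ^ 2
      * (2 * T) ^ (2 * n) < (2 * n - 1) * (2 * n)) :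
    NoUnitEigenvalue (limKernel n) t := by
  have hn' : (2 : ℝ) ≤ n := by exact_mod_cast hn
  have hm' : (3 : ℝ) ≤ m := by exact_mod_cast hm
  have hn1 : 0 < (n : ℝ) - 1 := by linarith
  have hm0 : 0 < (m : ℝ) := by linarith
  have hp0 : 0 ≤ p := Real.pi_pos.le.trans hp
  have hr0 : 0 ≤ r := (Real.sqrt_nonneg _).trans hr
  have hq0 : 0 ≤ q := (Real.exp_pos 1).le.trans hq
  rcases le_or_gt t 0 with ht0 | ht0
  · exact noUnitEigenvalue_of_small_window (M := 0) (fun u hu => by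
      have := abs_nonneg u; linarith) (by simp)
  have htm : 2 * t * m ≤ n - 1 := by nlinarith
  refine noUnitEigenvalue_limKernel_explicit hn' hm' htm ?_
  -- casts of the exponents
  have hcast : ((n : ℝ) - 1) = ((n - 1 : ℕ) : ℝ) := by
    rw [Nat.cast_sub (by omega)]; simp
  have hrp : ∀ x : ℝ, x ^ ((n : ℝ) - 1) = x ^ (n - 1) := fun x => by rw [hcast, Real.rpow_natCast]
  have hrp2 : ∀ x : ℝ, x ^ (2 * (n : ℝ)) = x ^ (2 * n) := fun x => by
    rw [show (2 : ℝ) * n = ((2 * n : ℕ) : ℝ) by push_cast; ring, Real.rpow_natCast]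
  -- `ε(m) ≤ ε⁺`
  have hε : 1 / (6 * (m : ℝ) ^ 2) + 1 / (Real.pi * (m : ℝ) ^ 3) + Real.pi ^ 2 / 6 * (2 : ℝ) ^ ((3 : ℝ) - m)
      ≤ 1 / (6 * (m : ℝ) ^ 2) + 1 / (3 * (m : ℝ) ^ 3) + p ^ 2 / 6 * (8 / 2 ^ m) := by
    have h1 : 1 / (Real.pi * (m : ℝ) ^ 3) ≤ 1 / (3 * (m : ℝ) ^ 3) := by
      have := Real.pi_gt_three.le; gcongr
    have h2 : (2 : ℝ) ^ ((3 : ℝ) - m) = 8 / 2 ^ m := by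
      rw [Real.rpow_sub (by norm_num), Real.rpow_natCast, show (3 : ℝ) = ((3 : ℕ) : ℝ) by norm_num,
        Real.rpow_natCast]
      norm_num
    have h3 : Real.pi ^ 2 / 6 * (2 : ℝ) ^ ((3 : ℝ) - m) ≤ p ^ 2 / 6 * (8 / 2 ^ m) := by
      rw [h2]; gcongr
    linarith
  have ha0 : 0 ≤ a := le_trans (by positivity) ha
  have hE : Real.exp (2 * n * (1 / (6 * (m : ℝ) ^ 2) + 1 / (Real.pi * (m : ℝ) ^ 3)
      + Real.pi ^ 2 / 6 * (2 : ℝ) ^ ((3 : ℝ) - m))) ≤ 1 + a + a ^ 2 := by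
    have h := (abs_le.mp (Real.abs_exp_sub_one_sub_id_le (x := a) (by rwa [abs_of_nonneg ha0]))).2
    calc Real.exp (2 * n * (1 / (6 * (m : ℝ) ^ 2) + 1 / (Real.pi * (m : ℝ) ^ 3)
          + Real.pi ^ 2 / 6 * (2 : ℝ) ^ ((3 : ℝ) - m)))
        ≤ Real.exp a := Real.exp_le_exp.mpr ((mul_le_mul_of_nonneg_left hε (by positivity)).trans ha)
      _ ≤ 1 + a + a ^ 2 := by linarith
  have h2T : (2 * t) ^ (2 * n) ≤ (2 * T) ^ (2 * n) :=
    pow_le_pow_left₀ (by linarith) (by linarith) _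
  rw [hrp, hrp, hrp2]
  calc ((2 * Real.pi) ^ (n - 1) * (Real.pi * Real.sqrt (2 / n)) * (Real.exp 1 / (n - 1)) ^ (n - 1)
        * Real.exp (2 * n * (1 / (6 * (m : ℝ) ^ 2) + 1 / (Real.pi * (m : ℝ) ^ 3)
          + Real.pi ^ 2 / 6 * (2 : ℝ) ^ ((3 : ℝ) - m)))) ^ 2 * (2 * t) ^ (2 * n)
      ≤ ((2 * p) ^ (n - 1) * (p * r) * (q / (n - 1)) ^ (n - 1) * (1 + a + a ^ 2)) ^ 2
        * (2 * T) ^ (2 * n) := by gcongr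
    _ < (2 * (n : ℝ) - 1) * (2 * (n : ℝ)) := hcond

/-- **θ = 12**: `±1 ∉ σ_p(𝖪₁₂[t])` for every `t ≤ 21/50 = 0.42` (RH-free; §7 evaluation with `σ₀ = 13`).
For comparison, the kit-certified (two-lineage, interval) Hilbert–Schmidt radius is `t_HS(12) = 0.827` and the
certified operator-norm windows reach `t = 1.4` (column DBR, DATA §ET1c); those are numerics, this is a kernel theorem. -/
theorem noUnitEigenvalue_limKernel_twelve {t : ℝ} (ht : t ≤ 21 / 50) : NoUnitEigenvalue (limKernel 12) t := by
  have h := noUnitEigenvalue_limKernel_of_rat_bounds (n := 12) (m := 13) (by norm_num) (by norm_num)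
    (t := t) (T := 21 / 50) (p := 3.1416) (q := 2.7182818286) (r := 1633 / 4000) (a := 8233 / 125000)
    Real.pi_lt_d4.le Real.exp_one_lt_d9.le
    (by rw [Real.sqrt_le_left (by norm_num)]; norm_num) (by norm_num) (by norm_num) ht (by norm_num)
    (by norm_num)
  exact_mod_cast h

/-- **θ = 20**: `±1 ∉ σ_p(𝖪₂₀[t])` for every `t ≤ 33/50 = 0.66` (RH-free; `σ₀ = 14`). -/
theorem noUnitEigenvalue_limKernel_twenty {t : ℝ} (ht : t ≤ 33 / 50) : NoUnitEigenvalue (limKernel 20) t := by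
  have h := noUnitEigenvalue_limKernel_of_rat_bounds (n := 20) (m := 14) (by norm_num) (by norm_num)
    (t := t) (T := 33 / 50) (p := 3.1416) (q := 2.7182818286) (r := 31623 / 100000) (a := 71001 / 1000000)
    Real.pi_lt_d4.le Real.exp_one_lt_d9.le
    (by rw [Real.sqrt_le_left (by norm_num)]; norm_num) (by norm_num) (by norm_num) ht (by norm_num)
    (by norm_num)
  exact_mod_cast h

/-- **θ = 24**: `±1 ∉ σ_p(𝖪₂₄[t])` for every `t ≤ 39/50 = 0.78` (RH-free; `σ₀ = 14`). -/
theorem noUnitEigenvalue_limKernel_twentyFour {t : ℝ} (ht : t ≤ 39 / 50) :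
    NoUnitEigenvalue (limKernel 24) t := by
  have h := noUnitEigenvalue_limKernel_of_rat_bounds (n := 24) (m := 14) (by norm_num) (by norm_num)
    (t := t) (T := 39 / 50) (p := 3.1416) (q := 2.7182818286) (r := 7217 / 25000) (a := 85201 / 1000000)
    Real.pi_lt_d4.le Real.exp_one_lt_d9.le
    (by rw [Real.sqrt_le_left (by norm_num)]; norm_num) (by norm_num) (by norm_num) ht (by norm_num)
    (by norm_num)
  exact_mod_cast h

/-- **θ = 40**: `±1 ∉ σ_p(𝖪₄₀[t])` for every `t ≤ 5/4` (RH-free; `σ₀ = 15`) — a kernel-checked clean window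
beyond `t = 1`. -/
theorem noUnitEigenvalue_limKernel_forty {t : ℝ} (ht : t ≤ 5 / 4) : NoUnitEigenvalue (limKernel 40) t := by
  have h := noUnitEigenvalue_limKernel_of_rat_bounds (n := 40) (m := 15) (by norm_num) (by norm_num)
    (t := t) (T := 5 / 4) (p := 3.1416) (q := 2.7182818286) (r := 22361 / 100000) (a := 99289 / 1000000)
    Real.pi_lt_d4.le Real.exp_one_lt_d9.le
    (by rw [Real.sqrt_le_left (by norm_num)]; norm_num) (by norm_num) (by norm_num) ht (by norm_num)
    (by norm_num)
  exact_mod_cast h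

end Summit.RiemannHypothesis.RiemannHypothesis.Theorems.SuzukiWindowsDoorExplicitWindow

end
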